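import Literature.NumberTheory.DiophantineGeometry.GeneralizedFermatTwoPowerCoefficientFreyIsogenyProofs
import Literature.NumberTheory.EllipticCurves.ThreeTorsionSwanAtTwoClassD10C4C6FreyProofs
import HarnessLib

/-!
# Ribet 1997, Theorem 3 — the Swan value of the Frey curve for `8 ∥ B`, and Theorem 3 from Serre's three inputs

Sibling `Proofs` file (theorems only: no `def`, no named fact, no `sorry`) of
`Literature.NumberTheory.DiophantineGeometry.GeneralizedFermatTwoPowerCoefficient`
(the named fact `ribet1997_twoPowerFermat`, K. Ribet, *On the equation
`a^p + 2^α b^p + c^p = 0`*, Acta Arith. **79** (1997), 7–16, Theorem 3) and of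
`…FreyIsogenyProofs`, which reduced Theorem 3 to Khare–Wintenberger (`hKW`), Mazur–Kenku (`hMK`),
Serre's weight-two statement (`hwt`) and the single local input `hSw₈` — for the normalised Frey
curve `E = freyCurve A B : y² = x (x − A) (x + B)` with `A ≡ −1 (mod 4)` and `8 ∥ B` (the `2`-adic
class `(ord₂ Δ, ord₂ c₄, ord₂ c₆) = (10, 4, 6)`, Kodaira `III*`, `f₂ = 3`, `δ₂ = 1`; Ribet 1997,
§2, p. 11, "`t = 3`", after Diamond–Kramer), `Sw_𝔓(E[3]) = 1` at a prime `𝔓 ∣ 2` of `\bar ℤ`.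
That input is now the theorem `WeierstrassCurve.swanConductorAt_torsion_three_of_class_D10C4C6_frey`
(`EllipticCurves/ThreeTorsionSwanAtTwoClassD10C4C6FreyProofs`, the fake-point method of the tree with
the fake point `P(X) = 6X + 72A`: on the Frey model `y ≈ x` on `E[3]`).

## What is proved here

* `swanConductorAt_torsion_three_freyCurve_of_eight_mul` — `Sw_𝔓((freyCurve A B)[3]) = 1` for
  `A ≡ −1 (mod 4)`, `B = 8b`, `b` odd, `AB(A + B) ≠ 0`, every `𝔓 ∣ 2`
  (`Ribet1997.freyCurve_class_of_eight_mul` fed to the class theorem);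
  `exists_swanConductorAt_torsion_three_freyCurve_of_sixteen_not_dvd` — the input `hSw` of
  `…FreySaitoProofs` in full (`4 ∣ B`, `16 ∤ B`; the case `4 ∥ B` is
  `swanConductorAt_torsion_three_freyCurve_of_four_mul` of `…FreyIsogenyProofs`).
* `ribet1997_twoPowerFermat_of_khare_wintenberger_of_mazurKenku_of_serreWeightTwo_only` — **Ribet's
  Theorem 3 from exactly the three deep inputs of Serre's road** (the `_only` distinguishes it from
  `…_of_serreWeightTwo hKW hMK hOS hwt` of `…TateProofs`, which still asked for Ogg–Saito `hOS`): Serre's conjecture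
  (Khare–Wintenberger–Kisin; the named fact `khare_wintenberger`), Mazur–Kenku (the named fact
  `mazurKenku_exists_cyclic_isogeny`) and Serre's weight-two statement for `E[p]` at a semistable
  `p ≥ 5` with `p ∣ ord_p Δ_min` (Serre 1987, §2.9 Prop. 5 with (4.1.11); the anonymous hypothesis
  `hwt`, not yet catalogued in `Literature`).  Every other ingredient of Ribet §2–§3 / Serre §4.1 —
  Frey arithmetic, Tate's algorithm at `2` and now Ogg's formula at `2` in Galois form for both
  additive Frey classes, `S₂(Γ₀(8)) = 0`, nebentypus descent, Néron–Ogg–Shafarevich, the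
  Tate-curve criterion at `ℓ ≠ p`, per-curve Carayol (4.6.3) — is a theorem of the tree.

[cite: Serre1987, §4.1–§4.2] [cite: SilvermanATAEC1994, Thm. IV.11.1]
-/

noncomputable section

open scoped MatrixGroups ModularForm NumberField
open Polynomial

namespace Literature.NumberTheory.DiophantineGeometry

open WeierstrassCurve GaloisRepresentations EllipticCurves EllipticCurves.ModularForms
  Rat.HeightOneSpectrum IsDedekindDomain IsDedekindDomain.HeightOneSpectrum Field
  Literature.NumberTheory.Automorphic Literature.NumberTheory.Automorphic.BCDT

attribute [local instance] AddSubgroup.torsionBy.zmodModule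

section Frey

variable {A B : ℤ}

/-- **`hSw₈`: `Sw_𝔓(E[3]) = 1` for the Frey curve with `8 ∥ B`.**  For `A ≡ −1 (mod 4)`, `B = 8b`
with `b` odd, `AB(A+B) ≠ 0` and every prime `𝔓` of `\bar ℤ` above the place `2`,
`Sw_𝔓((freyCurve A B)[3]) = 1` — the class data `Ribet1997.freyCurve_class_of_eight_mul`
(`c₄ = 2⁴c₄'`, `c₆ = 2⁶c₆'`, `Δ = 2¹⁰Δ'`, class `(10, 4, 6)`, Kodaira `III*`, `f₂ = 3`) fed to
`swanConductorAt_torsion_three_of_class_D10C4C6_frey`.  Galois side of Ogg's formula at `2`,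
[cite: SilvermanATAEC1994, Thm. IV.11.1]; Ribet 1997 §2 p. 11 (`t = 3` for `ord₂ B = 3`). -/
theorem swanConductorAt_torsion_three_freyCurve_of_eight_mul (h0 : A * B * (A + B) ≠ 0)
    (hA : A ≡ -1 [ZMOD 4]) {b : ℤ} (hB : B = 8 * b) (hb : Odd b)
    {v : HeightOneSpectrum (𝓞 ℚ)} (hv2 : (2 : 𝓞 ℚ) ∈ v.asIdeal)
    {𝔓 : Ideal (absIntegers (𝓞 ℚ) ℚ)} (h𝔓 : 𝔓 ∈ v.primesAbove) :
    ((freyCurve A B).torsionGaloisRep 3).swanConductorAt (𝓞 ℚ) 𝔓 = 1 := by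
  classical
  haveI hE : (freyCurve A B).IsElliptic := isElliptic_freyCurve h0
  have hA' : A % 4 = 3 := by unfold Int.ModEq at hA; omega
  have hAodd : Odd A := ⟨2 * (A / 4) + 1, by omega⟩
  have hb2 : b % 2 = 1 := Int.odd_iff.mp hb
  obtain ⟨hc4, hc6, hΔ, -, -, -⟩ := Ribet1997.freyCurve_class_of_eight_mul hAodd hB hb
  subst hB
  exact swanConductorAt_torsion_three_of_class_D10C4C6_frey (freyCurve A (8 * b)) hv2 h𝔓 hA' hb2
    rfl rfl (by ring) hc4 hc6 hΔ

/-- **`hSw` of `…FreySaitoProofs` in full**: for `A ≡ −1 (mod 4)`, `4 ∣ B`, `16 ∤ B`, `AB(A+B) ≠ 0`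
there is a prime `𝔓` of `\bar ℤ` above the place `2` of `𝓞 ℚ` with `Sw_𝔓((freyCurve A B)[3]) = 1`
(`4 ∥ B`: `swanConductorAt_torsion_three_freyCurve_of_four_mul`, by the `2`-isogeny onto the landed
class `D4C5C5M2R1M4R1`; `8 ∥ B`: `swanConductorAt_torsion_three_freyCurve_of_eight_mul`).
[cite: SilvermanATAEC1994, Thm. IV.11.1] -/
theorem exists_swanConductorAt_torsion_three_freyCurve_of_sixteen_not_dvd (h0 : A * B * (A + B) ≠ 0)
    (hA : A ≡ -1 [ZMOD 4]) (h4 : (4 : ℤ) ∣ B) (h16 : ¬ (16 : ℤ) ∣ B) :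
    ∃ 𝔓 ∈ ((primesEquiv (R := 𝓞 ℚ)).symm ⟨2, Nat.prime_two⟩).primesAbove,
      ((freyCurve A B).torsionGaloisRep 3).swanConductorAt (𝓞 ℚ) 𝔓 = 1 := by
  by_cases h8 : (8 : ℤ) ∣ B
  · have h2 : (2 : 𝓞 ℚ) ∈ ((primesEquiv (R := 𝓞 ℚ)).symm ⟨2, Nat.prime_two⟩).asIdeal := by
      have := (natCast_mem_asIdeal_iff_primesEquiv_eq
        ((primesEquiv (R := 𝓞 ℚ)).symm ⟨2, Nat.prime_two⟩) Nat.prime_two).mpr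
        (by rw [Equiv.apply_symm_apply])
      exact_mod_cast this
    obtain ⟨b, hb⟩ := h8
    have hbodd : Odd b := by
      rcases Int.even_or_odd b with ⟨c, hc⟩ | hodd
      · exact absurd ⟨c, by rw [hb, hc]; ring⟩ h16
      · exact hodd
    exact ⟨_, (HeightOneSpectrum.primesAbove_nonempty _).some_mem,
      swanConductorAt_torsion_three_freyCurve_of_eight_mul h0 hA hb hbodd h2
        (HeightOneSpectrum.primesAbove_nonempty _).some_mem⟩
  · exact exists_swanConductorAt_torsion_three_freyCurve_of_not_eight_dvd h0 hA h4 h8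

end Frey

section SerreRoad

open ValuativeRel GaloisRepresentations.ModPGaloisRep GaloisRepresentations.IsNonarchimedeanLocalField

/-- **Ribet 1997, Theorem 3, from the three deep inputs of Serre's road.**  `ribet1997_twoPowerFermat`
(no solutions of `x^p + 2^r y^p + z^p = 0`, `p ≥ 5` prime, `2 ≤ r < p`, in pairwise coprime
non-zero integers) follows from
* `hKW` — Serre's modularity conjecture, strong form (Khare–Wintenberger 2009, Kisin 2009; the
  named fact `khare_wintenberger`),
* `hMK` — Mazur 1978 + Kenku 1982 (the named fact `mazurKenku_exists_cyclic_isogeny`; gives the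
  irreducibility of `E[p]`, Ribet's Proposition 1 / Serre's Proposition 6), and
* `hwt` — Serre 1987, §2.9 Proposition 5 with (4.1.11): the Serre weight of `E[p]` is `2` for an
  elliptic curve `E/ℚ` semistable at `p ≥ 5` with `p ∣ ord_p Δ_min`,
everything else being proved in the tree (`…FreyProofs`, `…FreyTwoProofs`, `…SerreProofs`,
`…AssemblyProofs`, `…GoodReductionProofs`, `…TateProofs`, `MultiplicativeUnramifiedTorsionProofs`,
`…FreySaitoProofs`, `…FreyIsogenyProofs` and Part A of this file: the Swan values
`Sw_𝔓(E[3]) = 1` of both additive Frey classes, i.e. Ogg–Saito at `2` for the Frey curves).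
[cite: Serre1987, §4.1–§4.2] -/
theorem ribet1997_twoPowerFermat_of_khare_wintenberger_of_mazurKenku_of_serreWeightTwo_only
    (hKW : ∀ (p : ℕ) [Fact p.Prime] (k : Type) [Field k] [TopologicalSpace k] [DiscreteTopology k],
      khare_wintenberger p k)
    (hMK : mazurKenku_exists_cyclic_isogeny)
    (hwt : ∀ (W : WeierstrassCurve ℚ) [W.IsElliptic] (p : ℕ) [Fact p.Prime], 5 ≤ p →
      W.IsSemistableAt ((primesEquiv (R := ℤ)).symm ⟨p, Fact.out⟩) →
      p ∣ W.ordMinimalDiscriminant ((primesEquiv (R := ℤ)).symm ⟨p, Fact.out⟩) →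
      ∀ ρ : ModPGaloisRep ℚ (ZMod p) 2, W.IsTorsionGaloisRep p ρ →
        ∀ (k : Type) [Field k] [TopologicalSpace k] [DiscreteTopology k] [CharP k p]
          [IsAlgClosed k] (j : ZMod p →+* k)
          (loc : LocalRestrictionAt p (FramedRep.baseChange j continuous_of_discreteTopology ρ))
          (ι : absIntegers 𝒪[loc.F] loc.F ⧸ absMaximalIdeal loc.F →+* k),
          serreWeight p (FramedRep.baseChange j continuous_of_discreteTopology ρ) loc ι = 2) :
    ribet1997_twoPowerFermat :=
  ribet1997_twoPowerFermat_of_khare_wintenberger_of_mazurKenku_of_serreWeightTwo_of_freySwan hKW hMK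
    hwt fun _ _ _ h0 hA h4 h16 ↦
      exists_swanConductorAt_torsion_three_freyCurve_of_sixteen_not_dvd h0 hA h4 h16

end SerreRoad

end Literature.NumberTheory.DiophantineGeometry

end
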